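import Summits.NavierStokesRegularity.NavierStokesRegularity.Theorems.TerminalTraceTypeITraceScarL3LayerDecay
import Literature.Analysis.FluidPDE.PineauVicolOneSliceGradient

set_option linter.dupNamespace false

/-!
# The terminal-layer exponent `β* = 1/2` (nsreg-p2 g30, ROUND-33 v1.1) — part 3/3: the gradient
# companion discharged onto the pressure

Parts 1/3 (`…LayerDecaySubTypeI.lean`) and 2/3 (`…LayerDecay.lean`) prove Thm A/B/C of the plate.
This file adds Thm A′ `lipschitzCompanion_of_typeI_of_pressureOsc`: Type I in time + a scaled
pressure-OSCILLATION bound `≤ P` at the parabolic scale `c = √(T−t′)` below every `(t′,y)`,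
`y ∈ B(x₀,2ρ)` (invariant under `p ↦ p + c(t)`) ⇒ the one-sided Lipschitz companion with
`C_g = 2K+1`, by the tree's PROVED quantitative Serrin bound `exists_forall_fderiv_le_of_bounded`
(Pineau–Vicol 2026, Lemma 9.2 engine) + the mean value inequality on `B(x₀,2ρ)`; and Thm C′
`typeITraceScarL3_unitViscosity_of_layerDecay_of_pressureOsc` = item 18385's binders at `ν = 1` +
class {(a′) pressure oscillation, (b) the dial `inf_σ X(σ)/√σ = 0`, (c) `p ∈ L^{3/2}(Q_R)`} ⇒ the
conclusion — `u` enters the class only through the dial; Type I used four times.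
(Plate t34 v1.1 of nsreg-p2 g30, sha16 3bb61fc8d5dc7369, split in three files of at most 400 lines
for the gate; the declarations are those of the plate with the local notation `E3` spelled out.)
-/

noncomputable section

open MeasureTheory Set Function Metric Filter Topology Literature.Analysis.FluidPDE
open scoped ENNReal NNReal

namespace Summit.NavierStokesRegularity.NavierStokesRegularity.Theorems.TypeITraceScarL3

/-- **The gradient companion of Type I from a scaled pressure-oscillation bound (class (a) of
Theorem C discharged onto the pressure).**  For a classical solution on `[0,T)` with the Type-I
bound in time, if below every point `(t',y)`, `y ∈ B(x₀,2ρ)`, `t' ∈ (T₀,T)`, the mean-free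
pressure at the parabolic scale `c = √(T−t')` satisfies
`c⁻² ∫∫_{Q_c(t',y)} |p − h(s)|^{3/2} ≤ P` for some time-only function `h`, then `u(t,·)` is
Lipschitz on `B(x₀,2ρ)` with constant `(2K+1)/(T−t)`: the quantitative Serrin bound of
Pineau–Vicol (`exists_forall_fderiv_le_of_bounded`: `|u| ≤ A/c` on `Q_c` ⇒ `|∇u| ≤ K/c²` on
`Q_{c/2}`) applied on the cylinder of aperture `c = √(T − t − (T−t)/8)` hanging below
`(t + (T−t)/8, y)`, where Type I gives `|u| ≤ C_I/c`.  The pressure hypothesis is invariant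
under `p ↦ p + c(t)` and holds for the associated pressure under Type I
(`‖p(t)‖_{BMO} ≲ ‖u(t)‖²_∞ ≲ (T−t)⁻¹`, Seregin 2014 §6.3 p. 110) — not typed here.
[cite: PineauVicol2026, Lemma 9.2; Seregin2014, Ch. 6 §6.3] -/
theorem lipschitzCompanion_of_typeI_of_pressureOsc
    {u : ℝ → (EuclideanSpace ℝ (Fin 3)) → (EuclideanSpace ℝ (Fin 3))} {p : ℝ → (EuclideanSpace ℝ (Fin 3)) → ℝ} {T : ℝ} (hT : 0 < T)
    (hcl : IsClassicalNSSolutionOn (Set.Ico 0 T) 1 0 u p) (hTI : IsTypeIBlowup u T)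
    {x₀ : (EuclideanSpace ℝ (Fin 3))} {ρ T₀ : ℝ} {P : ℝ≥0} (hT₀ : T₀ < T)
    (hosc : ∀ t' ∈ Ioo T₀ T, ∀ y ∈ ball x₀ (2 * ρ), ∃ h : ℝ → ℝ,
      LocallyIntegrableOn (fun w : ℝ × (EuclideanSpace ℝ (Fin 3)) => h w.1)
        (parabolicCylinder (Real.sqrt (T - t')) (t', y)) volume ∧
      ∫⁻ w in parabolicCylinder (Real.sqrt (T - t')) (t', y), ‖p w.1 w.2 - h w.1‖ₑ ^ (3 / 2 : ℝ) ≤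
        ENNReal.ofReal (T - t') * P) :
    ∃ Cg T₁ : ℝ, 0 < Cg ∧ T₁ < T ∧ ∀ t ∈ Ioo T₁ T, ∀ x ∈ ball x₀ ρ, ∀ y ∈ ball x₀ (2 * ρ),
      ‖u t x‖ - ‖u t y‖ ≤ Cg / (T - t) * dist y x := by
  obtain ⟨C, δ, hC0, hδ, hδT, hrate⟩ := exists_typeI_rate_window hT hTI
  obtain ⟨K, hK0, hK⟩ := exists_forall_fderiv_le_of_bounded C P
  refine ⟨2 * K + 1, max T₀ (T - 4 * δ / 7), by positivity, max_lt hT₀ (by linarith), ?_⟩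
  intro t ht x hx y hy
  have htT₀ : T₀ < t := lt_of_le_of_lt (le_max_left _ _) ht.1
  have htδ : T - 4 * δ / 7 < t := lt_of_le_of_lt (le_max_right _ _) ht.1
  have htT : t < T := ht.2
  have ht0 : 0 ≤ t := by linarith
  -- the gradient bound at time `t` on the big ball, from the cylinder hanging below `(t', y')`
  have hgrad : ∀ y' ∈ ball x₀ (2 * ρ), ‖fderiv ℝ (u t) y'‖ ≤ (2 * K + 1) / (T - t) := by
    intro y' hy'
    set t' : ℝ := t + (T - t) / 8 with ht'_def
    have ht'T : t' < T := by rw [ht'_def]; linarith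
    have htt' : t < t' := by rw [ht'_def]; linarith
    have hTt' : 0 < T - t' := sub_pos.2 ht'T
    set c : ℝ := Real.sqrt (T - t') with hc_def
    have hc : 0 < c := Real.sqrt_pos.2 hTt'
    have hc2 : c ^ 2 = T - t' := Real.sq_sqrt hTt'.le
    -- the cylinder `Q_c(t', y')` sits inside `[0,T) × ℝ³` and inside the Type-I window
    have hQsub : parabolicCylinder c (t', y') ⊆ Set.Ico 0 T ×ˢ (univ : Set (EuclideanSpace ℝ (Fin 3))) := by
      intro w hw
      rw [mem_parabolicCylinder] at hw
      refine mem_prod.2 ⟨⟨?_, ?_⟩, mem_univ _⟩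
      · have h1 : t' - c ^ 2 < w.1 := hw.1.1
        rw [hc2, ht'_def] at h1; linarith
      · have h2 : w.1 < t' := hw.1.2
        linarith
    have hreg : IsClassicalNSSolutionOnRegion (parabolicCylinder c (t', y')) 1 0 u p :=
      hcl.onRegion.mono_of_isOpen hQsub (isOpen_parabolicCylinder c (t', y'))
    have hbd : ∀ w ∈ parabolicCylinder c (t', y'), ‖u w.1 w.2‖ ≤ C / c := by
      intro w hw
      rw [mem_parabolicCylinder] at hw
      have h1 : t' - c ^ 2 < w.1 := hw.1.1
      have h2 : w.1 < t' := hw.1.2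
      have hw1 : T - δ < w.1 := by rw [hc2, ht'_def] at h1; linarith
      have hwT : w.1 < T := by linarith
      have hr := hrate w.1 ⟨hw1, hwT⟩ w.2
      have hsq : c ≤ Real.sqrt (T - w.1) := by
        rw [hc_def]; exact Real.sqrt_le_sqrt (by linarith)
      have hsqpos : 0 < Real.sqrt (T - w.1) := lt_of_lt_of_le hc hsq
      rw [le_div_iff₀ hc]
      calc ‖u w.1 w.2‖ * c ≤ ‖u w.1 w.2‖ * Real.sqrt (T - w.1) :=
            mul_le_mul_of_nonneg_left hsq (norm_nonneg _)
        _ = Real.sqrt (T - w.1) * ‖u w.1 w.2‖ := by ring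
        _ ≤ C := hr
    obtain ⟨h, hh, hP⟩ := hosc t' ⟨by linarith, ht'T⟩ y' hy'
    have hP' : ∫⁻ w in parabolicCylinder c (t', y'), ‖p w.1 w.2 - h w.1‖ₑ ^ (3 / 2 : ℝ) ≤
        ENNReal.ofReal (c ^ 2) * P := by rwa [hc2]
    have hfd := hK u p h (t', y') c hc hreg hbd hh hP' (t, y') (by
      rw [mem_parabolicCylinder]
      refine ⟨⟨?_, htt'⟩, mem_ball_self (by positivity)⟩
      show t' - (c / 2) ^ 2 < t
      rw [div_pow, hc2, ht'_def]; linarith)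
    -- `K / c² = 8K / (7 (T − t)) ≤ (2K+1)/(T−t)`
    have hTt : 0 < T - t := sub_pos.2 htT
    calc ‖fderiv ℝ (u t) y'‖ ≤ K / c ^ 2 := hfd
      _ = K / (7 * (T - t) / 8) := by rw [hc2, ht'_def]; ring_nf
      _ ≤ (2 * K + 1) / (T - t) := by
          rw [div_le_div_iff₀ (by positivity) hTt]
          nlinarith
  -- mean value inequality on the convex ball `B(x₀, 2ρ)`
  have hdiff : ∀ y' ∈ ball x₀ (2 * ρ), DifferentiableAt ℝ (u t) y' := by
    intro y' _
    have hcd := hcl.smooth_velocity.contDiff_slice ⟨ht0, htT⟩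
    exact (hcd.differentiable (by simp)).differentiableAt
  have hx2 : x ∈ ball x₀ (2 * ρ) := by
    have hρ : 0 < ρ := lt_of_le_of_lt dist_nonneg (mem_ball.1 hx)
    exact ball_subset_ball (by linarith) hx
  have hmv := (convex_ball x₀ (2 * ρ)).norm_image_sub_le_of_norm_fderiv_le hdiff hgrad hx2 hy
  -- `‖u t x‖ − ‖u t y‖ ≤ ‖u t y − u t x‖ ≤ (2K+1)/(T−t) · ‖y − x‖`
  calc ‖u t x‖ - ‖u t y‖ ≤ ‖u t y - u t x‖ := by
        rw [norm_sub_rev]; exact norm_sub_norm_le _ _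
    _ ≤ (2 * K + 1) / (T - t) * ‖y - x‖ := hmv
    _ = (2 * K + 1) / (T - t) * dist y x := by rw [dist_eq_norm]

/-- **Theorem C with the gradient companion discharged onto the pressure** (`ν = 1`): item
`TerminalTrace.TypeITraceScarL3` at unit viscosity in the class of points `x₀` with
(a′) scaled pressure oscillation `≤ P` at the parabolic scale below every point near `x₀`
(holds for the associated pressure under Type I, Seregin 2014 §6.3; invariant under `p ↦ p + c(t)`),
(b) the terminal-layer dial below `√σ`, (c) `p ∈ L^{3/2}(Q_R(T,x₀))`.  Type I is used four times
(`exists_typeI_rate_window` for the Serrin cylinder, `morrey_of_typeI`, the rate window again for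
`C(r₀) < ∞`, `scaledEnergies_bounded_of_typeIRate`).
[cite: PineauVicol2026, Lemma 9.2; Seregin2020, (2.9); Seregin2014, Ch. 6 Prop. 3.11 (i)] -/
theorem typeITraceScarL3_unitViscosity_of_layerDecay_of_pressureOsc :
    ∀ T : ℝ, 0 < T →
    ∀ (u : ℝ → (EuclideanSpace ℝ (Fin 3)) → (EuclideanSpace ℝ (Fin 3))) (p : ℝ → (EuclideanSpace ℝ (Fin 3)) → ℝ),
      IsClassicalNSSolutionOn (Set.Ico 0 T) 1 0 u p →
      IsLerayHopfOn T 1 0 (u 0) u →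
      HasRapidSpatialDecay (u 0) →
      IsTypeIBlowup u T →
      ∀ x₀ : (EuclideanSpace ℝ (Fin 3)),
        (∃ ρ T₀ : ℝ, ∃ P : ℝ≥0, 0 < ρ ∧ T₀ < T ∧
          (∀ t' ∈ Ioo T₀ T, ∀ y ∈ ball x₀ (2 * ρ), ∃ h : ℝ → ℝ,
            LocallyIntegrableOn (fun w : ℝ × (EuclideanSpace ℝ (Fin 3)) => h w.1)
              (parabolicCylinder (Real.sqrt (T - t')) (t', y)) volume ∧
            ∫⁻ w in parabolicCylinder (Real.sqrt (T - t')) (t', y),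
                ‖p w.1 w.2 - h w.1‖ₑ ^ (3 / 2 : ℝ) ≤ ENNReal.ofReal (T - t') * P) ∧
          (∀ ε : ℝ, 0 < ε → ∃ τ : ℝ, 0 < τ ∧ τ ≤ 1 ∧ ∃ l₁ : ℝ, 0 < l₁ ∧
            ∀ l : ℝ, 0 < l → l ≤ l₁ → ∀ x ∈ ball x₀ ρ,
              ∫⁻ y in ball x l, ‖u (T - τ ^ 2 * l ^ 2) y‖ₑ ^ 2 ≤ ENNReal.ofReal (ε * τ * l))) →
        (∃ R : ℝ, 0 < R ∧ R ^ 2 ≤ T ∧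
          MemLp (Function.uncurry p) (3 / 2) (volume.restrict (parabolicCylinder R (T, x₀)))) →
        (∀ r : ℝ, 0 < r → eLpNorm (Function.uncurry u) ⊤
          (volume.restrict (parabolicCylinder r (T, x₀))) = ⊤) →
        ∀ ρ' : ℝ, 0 < ρ' → ¬ MemLp (u T) 3 (volume.restrict (ball x₀ ρ')) := by
  intro T hT u p hcl hLH hdec hTI x₀ hclass hpress hsing ρ' hρ'
  obtain ⟨ρ, T₀, P, hρ, hT₀, hosc, hlayer⟩ := hclass
  obtain ⟨Cg, T₁, hCg, hT₁, hlip⟩ :=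
    lipschitzCompanion_of_typeI_of_pressureOsc hT hcl hTI (x₀ := x₀) (ρ := ρ) hT₀ hosc
  exact typeITraceScarL3_unitViscosity_of_layerDecay T hT u p hcl hLH hdec hTI x₀
    ⟨ρ, Cg, T₁, hρ, hCg, hT₁, hlip, hlayer⟩ hpress hsing ρ' hρ'

end Summit.NavierStokesRegularity.NavierStokesRegularity.Theorems.TypeITraceScarL3

end
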